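/-
Copyright (c) 2026. All rights reserved.
Released under Apache 2.0 license as described in the file LICENSE.
-/
import Summits.AtomisticToContinuum.Crystallization.Theorems.OverbindingBudgetAffineFarStraighteningHook

/-!
# Overbinding budget — R_aff′ brick COMPAT, integer certificate (pair compatibility of snapped readings)

Slot Z of `stmt-AtomisticToContinuum-31280`, leaf `…FarSmoothSplit.AffineChartStraightening'` (R_aff′), brick R1d of the radial
development (g59 memo §3): two adjacent framed sites whose six shared points are relabelled by an ISOMETRIC snap `U` (brick SNAP)
produce two exact readings `insert 0 P` and `e + U (insert 0 P')`; COMPAT says these have NO NEAR-MISSES — two read points at distance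
`< 1` coincide.  This file is the finite half, stated on the integer models (`fccInt ∪ fccSecondShellInt` at scale `N = 2`,
`hcpInt ∪ hcpSecondShellInt` at `N = 18`) and proved by kernel `decide`, one instance per first-shell label `f` (1368 snaps × 361 pairs in
total; cross-checked in exact arithmetic by `g59/compat/compat_int3.py`: minimal nonzero squared distance exactly `1`).

The certificate for a snap `(e, f, c₁ ↦ d₁, c₂ ↦ d₂)` (`c₁, c₂` an independent pair of the common shell of `f`, `dᵢ − e = U (cᵢ)`):
* `SnapDecompOK` — the decomposition `8N(u − e) = 8A₀·e + K₁(2d₁ − e) + K₂(2d₂ − e)` of every read point `u` in the frame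
  `(e, 2d₁ − e, 2d₂ − e)` with the explicit integer coefficients `A₀ = u·e − N`, `Aᵢ = 2u·dᵢ − u·e`, `K₁ = 3A₁ − σA₂`,
  `K₂ = 3A₂ − σA₁` (`σ = ±1` the sign of the frame Gram entry);
* `SnapPairOK` — with `z = −8A₀ f + K₁(2c₁ − f) + K₂(2c₂ − f)` (so that `8N(u − e) = U z` in the real model), either `z = 8N u'`
  or `‖z − 8N u'‖² ≥ 64 N² N'`, i.e. `dist (u, e + U u') ∈ {0} ∪ [1, ∞)`.
The real transport is `…FarStraighteningCompat`.
-/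

namespace Summit.AtomisticToContinuum.Crystallization.Theorems.OverbindingBudgetAffineFarSmoothSplit

open Literature.Geometry.DiscreteGeometry (sqNormInt fccInt hcpInt fccSecondShellInt hcpSecondShellInt)

/-! ## §1  The integer quantities of a snap -/

/-- Sign of the frame Gram entry: `+1` when `⟪d₁ − e/2, d₂ − e/2⟫ = N/4`, else `−1`. [this file] -/
def snapSigma (N : ℤ) (d₁ d₂ : Fin 3 → ℤ) : ℤ := if 4 * dotInt d₁ d₂ - N = N then 1 else -1

/-- `A₀ = u·e − N` (the `e`-coefficient, times `N`). [this file] -/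
def snapA0 (N : ℤ) (e u : Fin 3 → ℤ) : ℤ := dotInt u e - N

/-- `A = 2u·d − u·e` (`= 2N ⟪u − e, d − e/2⟫`). [this file] -/
def snapA1 (e d u : Fin 3 → ℤ) : ℤ := 2 * dotInt u d - dotInt u e

/-- `K₁ = 3A₁ − σA₂` (the coefficient of `2d₁ − e`, times `8N`); `K₂` is `snapK N e d₂ d₁ u`. [this file] -/
def snapK (N : ℤ) (e d₁ d₂ u : Fin 3 → ℤ) : ℤ := 3 * snapA1 e d₁ u - snapSigma N d₁ d₂ * snapA1 e d₂ u

/-- The frame decomposition `8N(u − e) = 8A₀ e + K₁ (2d₁ − e) + K₂ (2d₂ − e)`, coordinatewise. [this file] -/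
def SnapDecompOK (N : ℤ) (e d₁ d₂ u : Fin 3 → ℤ) : Prop :=
  ∀ i : Fin 3, 8 * N * (u i - e i) =
    8 * snapA0 N e u * e i + snapK N e d₁ d₂ u * (2 * d₁ i - e i) + snapK N e d₂ d₁ u * (2 * d₂ i - e i)

/-- The pulled-back vector `z = −8A₀ f + K₁ (2c₁ − f) + K₂ (2c₂ − f)` (`U z = 8N(u − e)` in the real model). [this file] -/
def snapZ (N : ℤ) (e d₁ d₂ u f c₁ c₂ : Fin 3 → ℤ) : Fin 3 → ℤ := fun i =>
  -(8 * snapA0 N e u * f i) + snapK N e d₁ d₂ u * (2 * c₁ i - f i) + snapK N e d₂ d₁ u * (2 * c₂ i - f i)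

/-- The pair test: `z = 8N u'` (the two readings coincide) or `‖z − 8N u'‖² ≥ 64N²N'` (they are `≥ 1` apart). [this file] -/
def SnapPairOK (N N' : ℤ) (e d₁ d₂ u f c₁ c₂ u' : Fin 3 → ℤ) : Prop :=
  (∀ i : Fin 3, snapZ N e d₁ d₂ u f c₁ c₂ i = 8 * N * u' i) ∨
    64 * N ^ 2 * N' ≤ sqNormInt fun i => snapZ N e d₁ d₂ u f c₁ c₂ i - 8 * N * u' i

/-- The certificate core for a label `f` and a chosen independent pair `c₁, c₂` of its common shell: for every `e`, every Gram-matched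
image pair `d₁, d₂` which extends to a full snap (every common neighbour `c'` of `f` has an image `d` with the right inner products), every
read point `u` of the first site decomposes in the frame and passes the pair test against every read point `u'` of the second. [this file] -/
def SnapCompatCore (S S₂ : Finset (Fin 3 → ℤ)) (N : ℤ) (S' S₂' : Finset (Fin 3 → ℤ)) (N' : ℤ) (f c₁ c₂ : Fin 3 → ℤ) : Prop :=
  ∀ e ∈ S, ∀ d₁ ∈ S, ∀ d₂ ∈ S, sqNormInt (d₁ - e) = N → sqNormInt (d₂ - e) = N → N' * dotInt d₁ d₂ = N * dotInt c₁ c₂ →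
    (∀ c' ∈ S', sqNormInt (c' - f) = N' →
      ∃ d ∈ S, sqNormInt (d - e) = N ∧ N' * dotInt d d₁ = N * dotInt c' c₁ ∧ N' * dotInt d d₂ = N * dotInt c' c₂) →
      ∀ u ∈ insert (0 : Fin 3 → ℤ) (S ∪ S₂), SnapDecompOK N e d₁ d₂ u ∧
        ∀ u' ∈ insert (0 : Fin 3 → ℤ) (S' ∪ S₂'), SnapPairOK N N' e d₁ d₂ u f c₁ c₂ u'

/-- The certificate at a label `f`: an independent adjacent pair `c₁, c₂` (`⟪c₁,c₂⟫ ∈ {N'/2, 0}`) whose core passes. [this file] -/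
def SnapCompatAt (S S₂ : Finset (Fin 3 → ℤ)) (N : ℤ) (S' S₂' : Finset (Fin 3 → ℤ)) (N' : ℤ) (f : Fin 3 → ℤ) : Prop :=
  ∃ c₁ ∈ S', ∃ c₂ ∈ S', sqNormInt (c₁ - f) = N' ∧ sqNormInt (c₂ - f) = N' ∧ (2 * dotInt c₁ c₂ = N' ∨ dotInt c₁ c₂ = 0) ∧
    SnapCompatCore S S₂ N S' S₂' N' f c₁ c₂

/-! ## §2  The certificates (PROVED, kernel `decide`; one declaration per label `f` = one heartbeat budget each) -/
/-- COMPAT certificate `fcc ← fcc`, label `f = ![1, 1, 0]`. [this file] -/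
theorem snapCompatAt_fcc_fcc_0 : SnapCompatAt fccInt fccSecondShellInt 2 fccInt fccSecondShellInt 2 ![1, 1, 0] := by
  unfold SnapCompatAt SnapCompatCore SnapDecompOK SnapPairOK snapZ snapK snapA0 snapA1 snapSigma dotInt
  decide +kernel

/-- COMPAT certificate `fcc ← fcc`, label `f = ![1, -1, 0]`. [this file] -/
theorem snapCompatAt_fcc_fcc_1 : SnapCompatAt fccInt fccSecondShellInt 2 fccInt fccSecondShellInt 2 ![1, -1, 0] := by
  unfold SnapCompatAt SnapCompatCore SnapDecompOK SnapPairOK snapZ snapK snapA0 snapA1 snapSigma dotInt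
  decide +kernel

/-- COMPAT certificate `fcc ← fcc`, label `f = ![-1, 1, 0]`. [this file] -/
theorem snapCompatAt_fcc_fcc_2 : SnapCompatAt fccInt fccSecondShellInt 2 fccInt fccSecondShellInt 2 ![-1, 1, 0] := by
  unfold SnapCompatAt SnapCompatCore SnapDecompOK SnapPairOK snapZ snapK snapA0 snapA1 snapSigma dotInt
  decide +kernel

/-- COMPAT certificate `fcc ← fcc`, label `f = ![-1, -1, 0]`. [this file] -/
theorem snapCompatAt_fcc_fcc_3 : SnapCompatAt fccInt fccSecondShellInt 2 fccInt fccSecondShellInt 2 ![-1, -1, 0] := by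
  unfold SnapCompatAt SnapCompatCore SnapDecompOK SnapPairOK snapZ snapK snapA0 snapA1 snapSigma dotInt
  decide +kernel

/-- COMPAT certificate `fcc ← fcc`, label `f = ![1, 0, 1]`. [this file] -/
theorem snapCompatAt_fcc_fcc_4 : SnapCompatAt fccInt fccSecondShellInt 2 fccInt fccSecondShellInt 2 ![1, 0, 1] := by
  unfold SnapCompatAt SnapCompatCore SnapDecompOK SnapPairOK snapZ snapK snapA0 snapA1 snapSigma dotInt
  decide +kernel

/-- COMPAT certificate `fcc ← fcc`, label `f = ![1, 0, -1]`. [this file] -/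
theorem snapCompatAt_fcc_fcc_5 : SnapCompatAt fccInt fccSecondShellInt 2 fccInt fccSecondShellInt 2 ![1, 0, -1] := by
  unfold SnapCompatAt SnapCompatCore SnapDecompOK SnapPairOK snapZ snapK snapA0 snapA1 snapSigma dotInt
  decide +kernel

/-- COMPAT certificate `fcc ← fcc`, label `f = ![-1, 0, 1]`. [this file] -/
theorem snapCompatAt_fcc_fcc_6 : SnapCompatAt fccInt fccSecondShellInt 2 fccInt fccSecondShellInt 2 ![-1, 0, 1] := by
  unfold SnapCompatAt SnapCompatCore SnapDecompOK SnapPairOK snapZ snapK snapA0 snapA1 snapSigma dotInt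
  decide +kernel

/-- COMPAT certificate `fcc ← fcc`, label `f = ![-1, 0, -1]`. [this file] -/
theorem snapCompatAt_fcc_fcc_7 : SnapCompatAt fccInt fccSecondShellInt 2 fccInt fccSecondShellInt 2 ![-1, 0, -1] := by
  unfold SnapCompatAt SnapCompatCore SnapDecompOK SnapPairOK snapZ snapK snapA0 snapA1 snapSigma dotInt
  decide +kernel

/-- COMPAT certificate `fcc ← fcc`, label `f = ![0, 1, 1]`. [this file] -/
theorem snapCompatAt_fcc_fcc_8 : SnapCompatAt fccInt fccSecondShellInt 2 fccInt fccSecondShellInt 2 ![0, 1, 1] := by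
  unfold SnapCompatAt SnapCompatCore SnapDecompOK SnapPairOK snapZ snapK snapA0 snapA1 snapSigma dotInt
  decide +kernel

/-- COMPAT certificate `fcc ← fcc`, label `f = ![0, 1, -1]`. [this file] -/
theorem snapCompatAt_fcc_fcc_9 : SnapCompatAt fccInt fccSecondShellInt 2 fccInt fccSecondShellInt 2 ![0, 1, -1] := by
  unfold SnapCompatAt SnapCompatCore SnapDecompOK SnapPairOK snapZ snapK snapA0 snapA1 snapSigma dotInt
  decide +kernel

/-- COMPAT certificate `fcc ← fcc`, label `f = ![0, -1, 1]`. [this file] -/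
theorem snapCompatAt_fcc_fcc_10 : SnapCompatAt fccInt fccSecondShellInt 2 fccInt fccSecondShellInt 2 ![0, -1, 1] := by
  unfold SnapCompatAt SnapCompatCore SnapDecompOK SnapPairOK snapZ snapK snapA0 snapA1 snapSigma dotInt
  decide +kernel

/-- COMPAT certificate `fcc ← fcc`, label `f = ![0, -1, -1]`. [this file] -/
theorem snapCompatAt_fcc_fcc_11 : SnapCompatAt fccInt fccSecondShellInt 2 fccInt fccSecondShellInt 2 ![0, -1, -1] := by
  unfold SnapCompatAt SnapCompatCore SnapDecompOK SnapPairOK snapZ snapK snapA0 snapA1 snapSigma dotInt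
  decide +kernel

/-- **COMPAT certificate `fcc ← fcc`** (reading site `FCC`, read site `FCC`), all twelve labels. [this file] -/
theorem snapCompatAt_fcc_fcc : ∀ f ∈ fccInt, SnapCompatAt fccInt fccSecondShellInt 2 fccInt fccSecondShellInt 2 f := by
  intro f hf
  simp only [fccInt, Finset.mem_insert, Finset.mem_singleton] at hf
  rcases hf with rfl | rfl | rfl | rfl | rfl | rfl | rfl | rfl | rfl | rfl | rfl | rfl
  exacts [snapCompatAt_fcc_fcc_0, snapCompatAt_fcc_fcc_1, snapCompatAt_fcc_fcc_2, snapCompatAt_fcc_fcc_3,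
    snapCompatAt_fcc_fcc_4, snapCompatAt_fcc_fcc_5, snapCompatAt_fcc_fcc_6, snapCompatAt_fcc_fcc_7,
    snapCompatAt_fcc_fcc_8, snapCompatAt_fcc_fcc_9, snapCompatAt_fcc_fcc_10, snapCompatAt_fcc_fcc_11]

/-- COMPAT certificate `fcc ← hcp`, label `f = ![3, -3, 0]`. [this file] -/
theorem snapCompatAt_fcc_hcp_0 : SnapCompatAt fccInt fccSecondShellInt 2 hcpInt hcpSecondShellInt 18 ![3, -3, 0] := by
  unfold SnapCompatAt SnapCompatCore SnapDecompOK SnapPairOK snapZ snapK snapA0 snapA1 snapSigma dotInt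
  decide +kernel

/-- COMPAT certificate `fcc ← hcp`, label `f = ![-3, 3, 0]`. [this file] -/
theorem snapCompatAt_fcc_hcp_1 : SnapCompatAt fccInt fccSecondShellInt 2 hcpInt hcpSecondShellInt 18 ![-3, 3, 0] := by
  unfold SnapCompatAt SnapCompatCore SnapDecompOK SnapPairOK snapZ snapK snapA0 snapA1 snapSigma dotInt
  decide +kernel

/-- COMPAT certificate `fcc ← hcp`, label `f = ![3, 0, -3]`. [this file] -/
theorem snapCompatAt_fcc_hcp_2 : SnapCompatAt fccInt fccSecondShellInt 2 hcpInt hcpSecondShellInt 18 ![3, 0, -3] := by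
  unfold SnapCompatAt SnapCompatCore SnapDecompOK SnapPairOK snapZ snapK snapA0 snapA1 snapSigma dotInt
  decide +kernel

/-- COMPAT certificate `fcc ← hcp`, label `f = ![-3, 0, 3]`. [this file] -/
theorem snapCompatAt_fcc_hcp_3 : SnapCompatAt fccInt fccSecondShellInt 2 hcpInt hcpSecondShellInt 18 ![-3, 0, 3] := by
  unfold SnapCompatAt SnapCompatCore SnapDecompOK SnapPairOK snapZ snapK snapA0 snapA1 snapSigma dotInt
  decide +kernel

/-- COMPAT certificate `fcc ← hcp`, label `f = ![0, 3, -3]`. [this file] -/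
theorem snapCompatAt_fcc_hcp_4 : SnapCompatAt fccInt fccSecondShellInt 2 hcpInt hcpSecondShellInt 18 ![0, 3, -3] := by
  unfold SnapCompatAt SnapCompatCore SnapDecompOK SnapPairOK snapZ snapK snapA0 snapA1 snapSigma dotInt
  decide +kernel

/-- COMPAT certificate `fcc ← hcp`, label `f = ![0, -3, 3]`. [this file] -/
theorem snapCompatAt_fcc_hcp_5 : SnapCompatAt fccInt fccSecondShellInt 2 hcpInt hcpSecondShellInt 18 ![0, -3, 3] := by
  unfold SnapCompatAt SnapCompatCore SnapDecompOK SnapPairOK snapZ snapK snapA0 snapA1 snapSigma dotInt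
  decide +kernel

/-- COMPAT certificate `fcc ← hcp`, label `f = ![3, 3, 0]`. [this file] -/
theorem snapCompatAt_fcc_hcp_6 : SnapCompatAt fccInt fccSecondShellInt 2 hcpInt hcpSecondShellInt 18 ![3, 3, 0] := by
  unfold SnapCompatAt SnapCompatCore SnapDecompOK SnapPairOK snapZ snapK snapA0 snapA1 snapSigma dotInt
  decide +kernel

/-- COMPAT certificate `fcc ← hcp`, label `f = ![3, 0, 3]`. [this file] -/
theorem snapCompatAt_fcc_hcp_7 : SnapCompatAt fccInt fccSecondShellInt 2 hcpInt hcpSecondShellInt 18 ![3, 0, 3] := by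
  unfold SnapCompatAt SnapCompatCore SnapDecompOK SnapPairOK snapZ snapK snapA0 snapA1 snapSigma dotInt
  decide +kernel

/-- COMPAT certificate `fcc ← hcp`, label `f = ![0, 3, 3]`. [this file] -/
theorem snapCompatAt_fcc_hcp_8 : SnapCompatAt fccInt fccSecondShellInt 2 hcpInt hcpSecondShellInt 18 ![0, 3, 3] := by
  unfold SnapCompatAt SnapCompatCore SnapDecompOK SnapPairOK snapZ snapK snapA0 snapA1 snapSigma dotInt
  decide +kernel

/-- COMPAT certificate `fcc ← hcp`, label `f = ![-1, -1, -4]`. [this file] -/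
theorem snapCompatAt_fcc_hcp_9 : SnapCompatAt fccInt fccSecondShellInt 2 hcpInt hcpSecondShellInt 18 ![-1, -1, -4] := by
  unfold SnapCompatAt SnapCompatCore SnapDecompOK SnapPairOK snapZ snapK snapA0 snapA1 snapSigma dotInt
  decide +kernel

/-- COMPAT certificate `fcc ← hcp`, label `f = ![-1, -4, -1]`. [this file] -/
theorem snapCompatAt_fcc_hcp_10 : SnapCompatAt fccInt fccSecondShellInt 2 hcpInt hcpSecondShellInt 18 ![-1, -4, -1] := by
  unfold SnapCompatAt SnapCompatCore SnapDecompOK SnapPairOK snapZ snapK snapA0 snapA1 snapSigma dotInt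
  decide +kernel

/-- COMPAT certificate `fcc ← hcp`, label `f = ![-4, -1, -1]`. [this file] -/
theorem snapCompatAt_fcc_hcp_11 : SnapCompatAt fccInt fccSecondShellInt 2 hcpInt hcpSecondShellInt 18 ![-4, -1, -1] := by
  unfold SnapCompatAt SnapCompatCore SnapDecompOK SnapPairOK snapZ snapK snapA0 snapA1 snapSigma dotInt
  decide +kernel

/-- **COMPAT certificate `fcc ← hcp`** (reading site `FCC`, read site `HCP`), all twelve labels. [this file] -/
theorem snapCompatAt_fcc_hcp : ∀ f ∈ hcpInt, SnapCompatAt fccInt fccSecondShellInt 2 hcpInt hcpSecondShellInt 18 f := by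
  intro f hf
  simp only [hcpInt, Finset.mem_insert, Finset.mem_singleton] at hf
  rcases hf with rfl | rfl | rfl | rfl | rfl | rfl | rfl | rfl | rfl | rfl | rfl | rfl
  exacts [snapCompatAt_fcc_hcp_0, snapCompatAt_fcc_hcp_1, snapCompatAt_fcc_hcp_2, snapCompatAt_fcc_hcp_3,
    snapCompatAt_fcc_hcp_4, snapCompatAt_fcc_hcp_5, snapCompatAt_fcc_hcp_6, snapCompatAt_fcc_hcp_7,
    snapCompatAt_fcc_hcp_8, snapCompatAt_fcc_hcp_9, snapCompatAt_fcc_hcp_10, snapCompatAt_fcc_hcp_11]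

/-- COMPAT certificate `hcp ← fcc`, label `f = ![1, 1, 0]`. [this file] -/
theorem snapCompatAt_hcp_fcc_0 : SnapCompatAt hcpInt hcpSecondShellInt 18 fccInt fccSecondShellInt 2 ![1, 1, 0] := by
  unfold SnapCompatAt SnapCompatCore SnapDecompOK SnapPairOK snapZ snapK snapA0 snapA1 snapSigma dotInt
  decide +kernel

/-- COMPAT certificate `hcp ← fcc`, label `f = ![1, -1, 0]`. [this file] -/
theorem snapCompatAt_hcp_fcc_1 : SnapCompatAt hcpInt hcpSecondShellInt 18 fccInt fccSecondShellInt 2 ![1, -1, 0] := by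
  unfold SnapCompatAt SnapCompatCore SnapDecompOK SnapPairOK snapZ snapK snapA0 snapA1 snapSigma dotInt
  decide +kernel

/-- COMPAT certificate `hcp ← fcc`, label `f = ![-1, 1, 0]`. [this file] -/
theorem snapCompatAt_hcp_fcc_2 : SnapCompatAt hcpInt hcpSecondShellInt 18 fccInt fccSecondShellInt 2 ![-1, 1, 0] := by
  unfold SnapCompatAt SnapCompatCore SnapDecompOK SnapPairOK snapZ snapK snapA0 snapA1 snapSigma dotInt
  decide +kernel

/-- COMPAT certificate `hcp ← fcc`, label `f = ![-1, -1, 0]`. [this file] -/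
theorem snapCompatAt_hcp_fcc_3 : SnapCompatAt hcpInt hcpSecondShellInt 18 fccInt fccSecondShellInt 2 ![-1, -1, 0] := by
  unfold SnapCompatAt SnapCompatCore SnapDecompOK SnapPairOK snapZ snapK snapA0 snapA1 snapSigma dotInt
  decide +kernel

/-- COMPAT certificate `hcp ← fcc`, label `f = ![1, 0, 1]`. [this file] -/
theorem snapCompatAt_hcp_fcc_4 : SnapCompatAt hcpInt hcpSecondShellInt 18 fccInt fccSecondShellInt 2 ![1, 0, 1] := by
  unfold SnapCompatAt SnapCompatCore SnapDecompOK SnapPairOK snapZ snapK snapA0 snapA1 snapSigma dotInt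
  decide +kernel

/-- COMPAT certificate `hcp ← fcc`, label `f = ![1, 0, -1]`. [this file] -/
theorem snapCompatAt_hcp_fcc_5 : SnapCompatAt hcpInt hcpSecondShellInt 18 fccInt fccSecondShellInt 2 ![1, 0, -1] := by
  unfold SnapCompatAt SnapCompatCore SnapDecompOK SnapPairOK snapZ snapK snapA0 snapA1 snapSigma dotInt
  decide +kernel

/-- COMPAT certificate `hcp ← fcc`, label `f = ![-1, 0, 1]`. [this file] -/
theorem snapCompatAt_hcp_fcc_6 : SnapCompatAt hcpInt hcpSecondShellInt 18 fccInt fccSecondShellInt 2 ![-1, 0, 1] := by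
  unfold SnapCompatAt SnapCompatCore SnapDecompOK SnapPairOK snapZ snapK snapA0 snapA1 snapSigma dotInt
  decide +kernel

/-- COMPAT certificate `hcp ← fcc`, label `f = ![-1, 0, -1]`. [this file] -/
theorem snapCompatAt_hcp_fcc_7 : SnapCompatAt hcpInt hcpSecondShellInt 18 fccInt fccSecondShellInt 2 ![-1, 0, -1] := by
  unfold SnapCompatAt SnapCompatCore SnapDecompOK SnapPairOK snapZ snapK snapA0 snapA1 snapSigma dotInt
  decide +kernel

/-- COMPAT certificate `hcp ← fcc`, label `f = ![0, 1, 1]`. [this file] -/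
theorem snapCompatAt_hcp_fcc_8 : SnapCompatAt hcpInt hcpSecondShellInt 18 fccInt fccSecondShellInt 2 ![0, 1, 1] := by
  unfold SnapCompatAt SnapCompatCore SnapDecompOK SnapPairOK snapZ snapK snapA0 snapA1 snapSigma dotInt
  decide +kernel

/-- COMPAT certificate `hcp ← fcc`, label `f = ![0, 1, -1]`. [this file] -/
theorem snapCompatAt_hcp_fcc_9 : SnapCompatAt hcpInt hcpSecondShellInt 18 fccInt fccSecondShellInt 2 ![0, 1, -1] := by
  unfold SnapCompatAt SnapCompatCore SnapDecompOK SnapPairOK snapZ snapK snapA0 snapA1 snapSigma dotInt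
  decide +kernel

/-- COMPAT certificate `hcp ← fcc`, label `f = ![0, -1, 1]`. [this file] -/
theorem snapCompatAt_hcp_fcc_10 : SnapCompatAt hcpInt hcpSecondShellInt 18 fccInt fccSecondShellInt 2 ![0, -1, 1] := by
  unfold SnapCompatAt SnapCompatCore SnapDecompOK SnapPairOK snapZ snapK snapA0 snapA1 snapSigma dotInt
  decide +kernel

/-- COMPAT certificate `hcp ← fcc`, label `f = ![0, -1, -1]`. [this file] -/
theorem snapCompatAt_hcp_fcc_11 : SnapCompatAt hcpInt hcpSecondShellInt 18 fccInt fccSecondShellInt 2 ![0, -1, -1] := by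
  unfold SnapCompatAt SnapCompatCore SnapDecompOK SnapPairOK snapZ snapK snapA0 snapA1 snapSigma dotInt
  decide +kernel

/-- **COMPAT certificate `hcp ← fcc`** (reading site `HCP`, read site `FCC`), all twelve labels. [this file] -/
theorem snapCompatAt_hcp_fcc : ∀ f ∈ fccInt, SnapCompatAt hcpInt hcpSecondShellInt 18 fccInt fccSecondShellInt 2 f := by
  intro f hf
  simp only [fccInt, Finset.mem_insert, Finset.mem_singleton] at hf
  rcases hf with rfl | rfl | rfl | rfl | rfl | rfl | rfl | rfl | rfl | rfl | rfl | rfl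
  exacts [snapCompatAt_hcp_fcc_0, snapCompatAt_hcp_fcc_1, snapCompatAt_hcp_fcc_2, snapCompatAt_hcp_fcc_3,
    snapCompatAt_hcp_fcc_4, snapCompatAt_hcp_fcc_5, snapCompatAt_hcp_fcc_6, snapCompatAt_hcp_fcc_7,
    snapCompatAt_hcp_fcc_8, snapCompatAt_hcp_fcc_9, snapCompatAt_hcp_fcc_10, snapCompatAt_hcp_fcc_11]

/-- COMPAT certificate `hcp ← hcp`, label `f = ![3, -3, 0]`. [this file] -/
theorem snapCompatAt_hcp_hcp_0 : SnapCompatAt hcpInt hcpSecondShellInt 18 hcpInt hcpSecondShellInt 18 ![3, -3, 0] := by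
  unfold SnapCompatAt SnapCompatCore SnapDecompOK SnapPairOK snapZ snapK snapA0 snapA1 snapSigma dotInt
  decide +kernel

/-- COMPAT certificate `hcp ← hcp`, label `f = ![-3, 3, 0]`. [this file] -/
theorem snapCompatAt_hcp_hcp_1 : SnapCompatAt hcpInt hcpSecondShellInt 18 hcpInt hcpSecondShellInt 18 ![-3, 3, 0] := by
  unfold SnapCompatAt SnapCompatCore SnapDecompOK SnapPairOK snapZ snapK snapA0 snapA1 snapSigma dotInt
  decide +kernel

/-- COMPAT certificate `hcp ← hcp`, label `f = ![3, 0, -3]`. [this file] -/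
theorem snapCompatAt_hcp_hcp_2 : SnapCompatAt hcpInt hcpSecondShellInt 18 hcpInt hcpSecondShellInt 18 ![3, 0, -3] := by
  unfold SnapCompatAt SnapCompatCore SnapDecompOK SnapPairOK snapZ snapK snapA0 snapA1 snapSigma dotInt
  decide +kernel

/-- COMPAT certificate `hcp ← hcp`, label `f = ![-3, 0, 3]`. [this file] -/
theorem snapCompatAt_hcp_hcp_3 : SnapCompatAt hcpInt hcpSecondShellInt 18 hcpInt hcpSecondShellInt 18 ![-3, 0, 3] := by
  unfold SnapCompatAt SnapCompatCore SnapDecompOK SnapPairOK snapZ snapK snapA0 snapA1 snapSigma dotInt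
  decide +kernel

/-- COMPAT certificate `hcp ← hcp`, label `f = ![0, 3, -3]`. [this file] -/
theorem snapCompatAt_hcp_hcp_4 : SnapCompatAt hcpInt hcpSecondShellInt 18 hcpInt hcpSecondShellInt 18 ![0, 3, -3] := by
  unfold SnapCompatAt SnapCompatCore SnapDecompOK SnapPairOK snapZ snapK snapA0 snapA1 snapSigma dotInt
  decide +kernel

/-- COMPAT certificate `hcp ← hcp`, label `f = ![0, -3, 3]`. [this file] -/
theorem snapCompatAt_hcp_hcp_5 : SnapCompatAt hcpInt hcpSecondShellInt 18 hcpInt hcpSecondShellInt 18 ![0, -3, 3] := by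
  unfold SnapCompatAt SnapCompatCore SnapDecompOK SnapPairOK snapZ snapK snapA0 snapA1 snapSigma dotInt
  decide +kernel

/-- COMPAT certificate `hcp ← hcp`, label `f = ![3, 3, 0]`. [this file] -/
theorem snapCompatAt_hcp_hcp_6 : SnapCompatAt hcpInt hcpSecondShellInt 18 hcpInt hcpSecondShellInt 18 ![3, 3, 0] := by
  unfold SnapCompatAt SnapCompatCore SnapDecompOK SnapPairOK snapZ snapK snapA0 snapA1 snapSigma dotInt
  decide +kernel

/-- COMPAT certificate `hcp ← hcp`, label `f = ![3, 0, 3]`. [this file] -/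
theorem snapCompatAt_hcp_hcp_7 : SnapCompatAt hcpInt hcpSecondShellInt 18 hcpInt hcpSecondShellInt 18 ![3, 0, 3] := by
  unfold SnapCompatAt SnapCompatCore SnapDecompOK SnapPairOK snapZ snapK snapA0 snapA1 snapSigma dotInt
  decide +kernel

/-- COMPAT certificate `hcp ← hcp`, label `f = ![0, 3, 3]`. [this file] -/
theorem snapCompatAt_hcp_hcp_8 : SnapCompatAt hcpInt hcpSecondShellInt 18 hcpInt hcpSecondShellInt 18 ![0, 3, 3] := by
  unfold SnapCompatAt SnapCompatCore SnapDecompOK SnapPairOK snapZ snapK snapA0 snapA1 snapSigma dotInt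
  decide +kernel

/-- COMPAT certificate `hcp ← hcp`, label `f = ![-1, -1, -4]`. [this file] -/
theorem snapCompatAt_hcp_hcp_9 : SnapCompatAt hcpInt hcpSecondShellInt 18 hcpInt hcpSecondShellInt 18 ![-1, -1, -4] := by
  unfold SnapCompatAt SnapCompatCore SnapDecompOK SnapPairOK snapZ snapK snapA0 snapA1 snapSigma dotInt
  decide +kernel

/-- COMPAT certificate `hcp ← hcp`, label `f = ![-1, -4, -1]`. [this file] -/
theorem snapCompatAt_hcp_hcp_10 : SnapCompatAt hcpInt hcpSecondShellInt 18 hcpInt hcpSecondShellInt 18 ![-1, -4, -1] := by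
  unfold SnapCompatAt SnapCompatCore SnapDecompOK SnapPairOK snapZ snapK snapA0 snapA1 snapSigma dotInt
  decide +kernel

/-- COMPAT certificate `hcp ← hcp`, label `f = ![-4, -1, -1]`. [this file] -/
theorem snapCompatAt_hcp_hcp_11 : SnapCompatAt hcpInt hcpSecondShellInt 18 hcpInt hcpSecondShellInt 18 ![-4, -1, -1] := by
  unfold SnapCompatAt SnapCompatCore SnapDecompOK SnapPairOK snapZ snapK snapA0 snapA1 snapSigma dotInt
  decide +kernel

/-- **COMPAT certificate `hcp ← hcp`** (reading site `HCP`, read site `HCP`), all twelve labels. [this file] -/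
theorem snapCompatAt_hcp_hcp : ∀ f ∈ hcpInt, SnapCompatAt hcpInt hcpSecondShellInt 18 hcpInt hcpSecondShellInt 18 f := by
  intro f hf
  simp only [hcpInt, Finset.mem_insert, Finset.mem_singleton] at hf
  rcases hf with rfl | rfl | rfl | rfl | rfl | rfl | rfl | rfl | rfl | rfl | rfl | rfl
  exacts [snapCompatAt_hcp_hcp_0, snapCompatAt_hcp_hcp_1, snapCompatAt_hcp_hcp_2, snapCompatAt_hcp_hcp_3,
    snapCompatAt_hcp_hcp_4, snapCompatAt_hcp_hcp_5, snapCompatAt_hcp_hcp_6, snapCompatAt_hcp_hcp_7,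
    snapCompatAt_hcp_hcp_8, snapCompatAt_hcp_hcp_9, snapCompatAt_hcp_hcp_10, snapCompatAt_hcp_hcp_11]

end Summit.AtomisticToContinuum.Crystallization.Theorems.OverbindingBudgetAffineFarSmoothSplit
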